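import Summits.RiemannHypothesis.RiemannHypothesis.Theorems.SpectralTraceWindowStepSharpMultiplicityCap
import Summits.RiemannHypothesis.RiemannHypothesis.Theorems.SpectralTraceWindowTraceArchStubCountingLaw
import Summits.RiemannHypothesis.RiemannHypothesis.Theorems.SpectralTraceWindowTraceArchStubBandlimitedTest
import Summits.RiemannHypothesis.RiemannHypothesis.Theorems.SpectralTraceWindowTraceArchStubSelbergTests
import Summits.RiemannHypothesis.RiemannHypothesis.Theorems.SpectralTraceWindowTraceArchStubStructureAssemblyAux
import Literature.NumberTheory.LFunctions.RiemannSiegelThetaBounds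
import Literature.NumberTheory.LFunctions.WeilGroundState
import HarnessLib

/-!
# The saturation profile of a coagulated family (`stub_saturationProfile`, line `split-birth`)

Route `RiemannHypothesis/SpectralTrace`, crux `WindowStep` (stmt-RiemannHypothesis-14659), line
`split-birth`, registered stub `stub_saturationProfile` (RH-free, pure counting).

**Statement.** Let `a ≥ (log 3)/2`, `u : ℝ → ℂ` (a ground state of `[-a, a]`; only its real zero set
`Z = {x : û(1/2 + ix) = 0}` enters), and assume the Levinson–Cartwright upper bound (hypothesis):
for every `η₂ > 0`, every finite set of points of `Z ∩ [-r, r]` has at most `(2a/π + η₂) r` elements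
once `r ≥ r₀(η₂)`. Let `γ : ι → ℝ` reproduce the Weil functional on the Weil tests supported in
`[-2a, 2a]` and lie inside `Z`. Then for every `η > 0` and all large `r` there is a finite set of
at least `(2a/π − η) r` points `x ∈ Z ∩ [-r, r]` which are SATURATED:
`(1/(2a) − η) log|x| ≤ #{i | γ i = x}`.

**Proof (the counting budget closes).** WLOG `η ≤ 1/(2a)` (shrinking `η` only strengthens the
conclusion, all selected points having `|x| ≥ 1`).
1. Since `2a ≥ log 3 > log 2`, `γ` and its reflection `−γ` (`stub_structureAssembly_reflect`) are
   witnesses of the `[-log 2, log 2]` window, so the two-sided counting law `stub_countingLaw`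
   (fed with the landed `stub_bandlimitedTest`, `stub_selbergTests`) and the explicit Stirling
   bound `abs_riemannSiegelTheta_sub_stirlingMain_le` give `N(r) := #{i | |γ i| ≤ r} ≥ (r/π) log r − K r`
   for `r ≥ 1` (`{|γ| ≤ r} = {γ ∈ [0, r]} ∪ {−γ ∈ [0, r]}`, intersection = the finite fibre of `0`).
2. Fibre decomposition of the finite index set over its (finite) set `P` of values with
   `|x| ≥ X'` (`X' ≥ e` beyond the threshold of the sharp cap `ncard_fibre_le_sharp` at `η₁ = δ`):
   `N(r) ≤ M₀ + #Zsat (1/(2a) + δ) log r + #U (1/(2a) − η) log r`, `#Zsat + #U = #P ≤ (2a/π + δ) r`.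
3. With `δ = η²/(2(1/(2a) + 2a/π + 1))` the two bounds force `#Zsat ≥ (2a/π − η) r` as soon as
   `log r ≥ 2(|K| + M₀)/η²` (`saturationProfile_budget`, elementary algebra).

All ingredients are landed tree theorems / Mathlib; no named fact is used; no definitions.
-/

set_option linter.dupNamespace false

noncomputable section

open Complex Set Filter MeasureTheory
open scoped Real Topology BigOperators

namespace Summit.RiemannHypothesis.RiemannHypothesis.Theorems.SpectralTraceWindowStep

open Literature.NumberTheory.LFunctions
open Summit.RiemannHypothesis.RiemannHypothesis.Theorems.WindowTraceArch.Negative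
open Summit.RiemannHypothesis.RiemannHypothesis.Theorems.SpectralTraceWindowTraceArch

/-! ## §1 The elementary budget inequality -/

/-- **The counting budget (pure algebra).** If `N ≥ p r L − K r` (counting law from below),
`N ≤ M₀ + Zc (c + δ) L + Uc (c − η) L` (fibre decomposition: saturated values capped at `(c + δ) L`,
unsaturated ones below `(c − η) L`), `Zc + Uc ≤ (b + δ) r` (density of the zero set), `b c = p`,
`η ≤ c`, `2δ(c + b) ≤ η²` and `2(K + M₀) ≤ L η²` (`L, r ≥ 1`), then `Zc ≥ (b − η) r`. [folklore] -/
theorem saturationProfile_budget {b c p η δ r L N Zc Uc M₀ K : ℝ} (hη : 0 < η) (hδ : 0 < δ)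
    (hcη : η ≤ c) (hbc : b * c = p) (hδs : 2 * (δ * (c + b)) ≤ η ^ 2) (hL : 1 ≤ L) (hr : 1 ≤ r)
    (hU : 0 ≤ Uc) (hM : 0 ≤ M₀) (hK : 2 * (K + M₀) ≤ L * η ^ 2)
    (hN1 : p * r * L - K * r ≤ N) (hN2 : N ≤ M₀ + Zc * ((c + δ) * L) + Uc * ((c - η) * L))
    (hP : Zc + Uc ≤ (b + δ) * r) : (b - η) * r ≤ Zc := by
  by_contra hcon
  have hlt : Zc < (b - η) * r := not_le.1 hcon
  have hrL : 0 ≤ r * L := mul_nonneg (by linarith) (by linarith)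
  have hηδL : 0 < (η + δ) * L := mul_pos (by linarith) (by linarith)
  have h1 : Uc * ((c - η) * L) ≤ ((b + δ) * r - Zc) * ((c - η) * L) :=
    mul_le_mul_of_nonneg_right (by linarith) (mul_nonneg (by linarith) (by linarith))
  have h2 : Zc * ((η + δ) * L) < (b - η) * r * ((η + δ) * L) :=
    mul_lt_mul_of_pos_right hlt hηδL
  have h3 : 2 * (δ * (c + b)) * (r * L) ≤ η ^ 2 * (r * L) :=
    mul_le_mul_of_nonneg_right hδs hrL
  have h4 : 0 ≤ η * δ * (r * L) := mul_nonneg (mul_nonneg hη.le hδ.le) hrL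
  have h5 : 2 * (K + M₀) * r ≤ L * η ^ 2 * r := mul_le_mul_of_nonneg_right hK (by linarith)
  have h6 : M₀ ≤ M₀ * r := le_mul_of_one_le_right hM hr
  have h7 : b * c * (r * L) = p * (r * L) := by rw [hbc]
  have hU' : 0 ≤ Uc * ((c - η) * L) := mul_nonneg hU (mul_nonneg (by linarith) (by linarith))
  linarith [h1, h2, h3, h4, h5, h6, h7, hN1, hN2, hU']

/-! ## §2 The core statement at a small `η` -/

/-- **Core of `stub_saturationProfile` (for `0 < η ≤ 1/(2a)`, selected points with `|x| ≥ 1`).**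
With `b = 2a/π`, `c = 1/(2a)`: from the density hypothesis on the real zeros of `û(1/2 + i·)`,
a level-`2a` family `γ` inside that zero set has, for all large `r`, at least `(b − η) r` values
`x` with `1 ≤ |x| ≤ r` and `(c − η) log|x| ≤ #{i | γ i = x}`. Proof: two-sided counting law
(`stub_countingLaw` for `γ` and `−γ`, explicit Stirling for `θ`) from below, fibre decomposition
with the sharp cap `ncard_fibre_le_sharp` from above, and `saturationProfile_budget`. [folklore] -/
theorem saturationProfile_core {a η b c : ℝ} (ha : 0 < a) (ha2 : Real.log 2 ≤ 2 * a)
    (hb : b = 2 * a / π) (hc : c = 1 / (2 * a)) (hη : 0 < η) (hηc : η ≤ c) (u : ℝ → ℂ)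
    (H1 : ∀ η : ℝ, 0 < η → ∃ r₀ : ℝ, ∀ r : ℝ, r₀ ≤ r → ∀ Z : Finset ℝ,
      (∀ x ∈ Z, |x| ≤ r ∧ weilMellin u (1 / 2 + (x : ℂ) * I) = 0) →
        (Z.card : ℝ) ≤ (b + η) * r)
    {ι : Type} {γ : ι → ℝ}
    (hγ : ∀ g : ℝ → ℂ, IsWeilTest g → tsupport g ⊆ Icc (-(2 * a)) (2 * a) →
      HasSum (fun i => weilMellin g (1 / 2 + (γ i : ℂ) * I)) (weilFunctional g))
    (hvan : ∀ i : ι, weilMellin u (1 / 2 + (γ i : ℂ) * I) = 0) :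
    ∃ r₀ : ℝ, 0 ≤ r₀ ∧ ∀ r : ℝ, r₀ ≤ r → ∃ Z : Finset ℝ,
      (∀ x ∈ Z, 1 ≤ |x| ∧ |x| ≤ r ∧ weilMellin u (1 / 2 + (x : ℂ) * I) = 0 ∧
        (c - η) * Real.log |x| ≤ ({i : ι | γ i = x}.ncard : ℝ)) ∧
      (b - η) * r ≤ (Z.card : ℝ) := by
  classical
  have hπ : 0 < π := Real.pi_pos
  -- the constant `p = 1/π` and `b c = p`
  obtain ⟨p, hp⟩ : ∃ p : ℝ, p = π⁻¹ := ⟨_, rfl⟩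
  have hp0 : 0 < p := by rw [hp]; exact inv_pos.2 hπ
  have hp2 : p ≤ 1 / 2 := by
    rw [hp, inv_eq_one_div]
    exact one_div_le_one_div_of_le (by norm_num) (by linarith [Real.pi_gt_three])
  have hc0 : 0 < c := by rw [hc]; positivity
  have hb0 : 0 < b := by rw [hb]; positivity
  have hbc : b * c = p := by
    rw [hb, hc, hp]
    field_simp
  -- the auxiliary parameter `δ`
  obtain ⟨δ, hδ⟩ : ∃ δ : ℝ, δ = η ^ 2 / (2 * (c + b + 1)) := ⟨_, rfl⟩
  have hδ0 : 0 < δ := by rw [hδ]; positivity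
  have hδs : 2 * (δ * (c + b)) ≤ η ^ 2 := by
    have e : δ * (2 * (c + b + 1)) = η ^ 2 := by
      rw [hδ]
      field_simp
    nlinarith [e, hδ0]
  -- the sharp cap beyond `X`, and `X' = max X e`
  obtain ⟨X, hX⟩ := ncard_fibre_le_sharp a ha δ hδ0
  obtain ⟨X', hXX', hX'e⟩ : ∃ X' : ℝ, X ≤ X' ∧ Real.exp 1 ≤ X' :=
    ⟨max X (Real.exp 1), le_max_left _ _, le_max_right _ _⟩
  have hX'1 : 1 ≤ X' := le_trans (by linarith [Real.add_one_le_exp (1 : ℝ)]) hX'e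
  have hX'0 : 0 < X' := by linarith
  -- the density hypothesis at `δ`
  obtain ⟨r₁, hr₁⟩ := H1 δ hδ0
  -- `γ` and `-γ` are witnesses of the `log 2` window
  have hγ2 : ∀ g : ℝ → ℂ, IsWeilTest g → tsupport g ⊆ Icc (-Real.log 2) (Real.log 2) →
      HasSum (fun i => weilMellin g (1 / 2 + (γ i : ℂ) * I)) (weilFunctional g) :=
    fun g hg hgs => hγ g hg (hgs.trans (Icc_subset_Icc (by linarith) ha2))
  have hγ2' := stub_structureAssembly_reflect hγ2
  have hCL := stub_countingLaw stub_bandlimitedTest stub_selbergTests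
  obtain ⟨C, hC⟩ := hCL ι γ hγ2
  obtain ⟨C', hC'⟩ := hCL ι (fun i => -γ i) hγ2'
  -- finiteness of balls and fibres
  have hSfin : ∀ R : ℝ, {i : ι | |γ i| ≤ R}.Finite :=
    finite_abs_le_of_windowTrace (by positivity : (0 : ℝ) < 2 * a) hγ
  have hFfin : ∀ x : ℝ, {i : ι | γ i = x}.Finite := fun x =>
    (hSfin |x|).subset fun i hi => by
      simp only [mem_setOf_eq] at hi ⊢
      rw [hi]
  obtain ⟨m0, hm0⟩ : ∃ M : ℕ, M = {i : ι | γ i = 0}.ncard := ⟨_, rfl⟩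
  obtain ⟨M₀, hM₀⟩ : ∃ M : ℕ, M = {i : ι | |γ i| ≤ X'}.ncard := ⟨_, rfl⟩
  -- the Stirling constant and the lower-order constant `K`
  obtain ⟨c₀, hc₀⟩ : ∃ c₀ : ℝ,
      c₀ = riemannSiegelTheta 1 - (1 / 2 * Real.log (1 / (2 * π)) - 1 / 2) := ⟨_, rfl⟩
  obtain ⟨K, hK⟩ : ∃ K : ℝ,
      K = (Real.log (2 * π) + 1) * p + 4 * p + 2 * (|C| + |C'|) + |c₀| + (m0 : ℝ) := ⟨_, rfl⟩
  -- (1) the lower bound `N(T) ≥ (T/π) log T − K T`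
  have hlow : ∀ T : ℝ, 1 ≤ T →
      p * T * Real.log T - K * T ≤ (({i : ι | |γ i| ≤ T}.ncard : ℕ) : ℝ) := by
    intro T hT1
    have hT0 : (0 : ℝ) ≤ T := by linarith
    have hTpos : (0 : ℝ) < T := by linarith
    obtain ⟨hAfin, hA⟩ := hC T hT0
    obtain ⟨hBfin, hB⟩ := hC' T hT0
    have hA' : |(({i : ι | γ i ∈ Icc 0 T}.ncard : ℕ) : ℝ) - riemannSiegelTheta T / π| ≤
        C * (1 + Real.log (1 + T)) := hA
    have hBfin' : {i : ι | -γ i ∈ Icc 0 T}.Finite := hBfin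
    have hB' : |(({i : ι | -γ i ∈ Icc 0 T}.ncard : ℕ) : ℝ) - riemannSiegelTheta T / π| ≤
        C' * (1 + Real.log (1 + T)) := hB
    have hunion : {i : ι | γ i ∈ Icc 0 T} ∪ {i : ι | -γ i ∈ Icc 0 T} = {i : ι | |γ i| ≤ T} := by
      ext i
      simp only [mem_union, mem_setOf_eq, mem_Icc, abs_le]
      constructor
      · rintro (⟨h1, h2⟩ | ⟨h1, h2⟩) <;> constructor <;> linarith
      · rintro ⟨h1, h2⟩
        rcases le_or_gt 0 (γ i) with h | h
        · exact Or.inl ⟨h, h2⟩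
        · exact Or.inr ⟨by linarith, by linarith⟩
    have hinter : {i : ι | γ i ∈ Icc 0 T} ∩ {i : ι | -γ i ∈ Icc 0 T} ⊆ {i : ι | γ i = 0} := by
      rintro i ⟨⟨h1, -⟩, ⟨h2, -⟩⟩
      show γ i = 0
      linarith
    have hcard : ({i : ι | γ i ∈ Icc 0 T} ∪ {i : ι | -γ i ∈ Icc 0 T}).ncard +
        ({i : ι | γ i ∈ Icc 0 T} ∩ {i : ι | -γ i ∈ Icc 0 T}).ncard =
        {i : ι | γ i ∈ Icc 0 T}.ncard + {i : ι | -γ i ∈ Icc 0 T}.ncard :=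
      Set.ncard_union_add_ncard_inter _ _ hAfin hBfin'
    rw [hunion] at hcard
    have hle : ({i : ι | γ i ∈ Icc 0 T} ∩ {i : ι | -γ i ∈ Icc 0 T}).ncard ≤
        {i : ι | γ i = 0}.ncard := Set.ncard_le_ncard hinter (hFfin 0)
    have hsum : (({i : ι | γ i ∈ Icc 0 T}.ncard : ℕ) : ℝ) +
        (({i : ι | -γ i ∈ Icc 0 T}.ncard : ℕ) : ℝ) ≤
        (({i : ι | |γ i| ≤ T}.ncard : ℕ) : ℝ) + (m0 : ℝ) := by
      rw [hm0]
      have h : {i : ι | γ i ∈ Icc 0 T}.ncard + {i : ι | -γ i ∈ Icc 0 T}.ncard ≤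
          {i : ι | |γ i| ≤ T}.ncard + {i : ι | γ i = 0}.ncard := by
        rw [← hcard]
        exact Nat.add_le_add_left hle _
      exact_mod_cast h
    -- Stirling from below
    have hθ := abs_riemannSiegelTheta_sub_stirlingMain_le hT1
    rw [← hc₀] at hθ
    have hθ' := (abs_le.1 hθ).1
    have hlogdiv : Real.log (T / (2 * π)) = Real.log T - Real.log (2 * π) :=
      Real.log_div hTpos.ne' (by positivity)
    rw [hlogdiv] at hθ'
    have hlogT : Real.log T ≤ T := by linarith [Real.log_le_sub_one_of_pos hTpos]
    have hlogT0 : 0 ≤ Real.log T := Real.log_nonneg hT1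
    have hlog1T : Real.log (1 + T) ≤ T := by
      linarith [Real.log_le_sub_one_of_pos (by linarith : (0 : ℝ) < 1 + T)]
    have hlog1T0 : 0 ≤ Real.log (1 + T) := Real.log_nonneg (by linarith)
    rw [div_eq_mul_inv, ← hp] at hA' hB'
    have hA'' := (abs_le.1 hA').1
    have hB'' := (abs_le.1 hB').1
    have hθp : (T / 2 * (Real.log T - Real.log (2 * π)) - T / 2 + c₀ - 2 * Real.log T) * p ≤
        riemannSiegelTheta T * p := mul_le_mul_of_nonneg_right (by linarith) hp0.le
    have e1 : Real.log T * p ≤ T * p := mul_le_mul_of_nonneg_right hlogT hp0.le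
    have e2 : -|c₀| * p ≤ c₀ * p := mul_le_mul_of_nonneg_right (neg_abs_le c₀) hp0.le
    have e3 : |c₀| * p ≤ |c₀| * (1 / 2) := mul_le_mul_of_nonneg_left hp2 (abs_nonneg c₀)
    have e4 : |c₀| ≤ |c₀| * T := le_mul_of_one_le_right (abs_nonneg _) hT1
    have e5 : (m0 : ℝ) ≤ (m0 : ℝ) * T := le_mul_of_one_le_right (Nat.cast_nonneg _) hT1
    have e6 : C * (1 + Real.log (1 + T)) ≤ |C| * (2 * T) :=
      (mul_le_mul_of_nonneg_right (le_abs_self C) (by linarith)).trans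
        (mul_le_mul_of_nonneg_left (by linarith) (abs_nonneg C))
    have e7 : C' * (1 + Real.log (1 + T)) ≤ |C'| * (2 * T) :=
      (mul_le_mul_of_nonneg_right (le_abs_self C') (by linarith)).trans
        (mul_le_mul_of_nonneg_left (by linarith) (abs_nonneg C'))
    have e8 : 0 ≤ T * p := mul_nonneg hT0 hp0.le
    rw [hK]
    linarith [hsum, hA'', hB'', hθp, e1, e2, e3, e4, e5, e6, e7, e8]
  -- the threshold
  obtain ⟨R, hR⟩ : ∃ R : ℝ, R = Real.exp (2 * (|K| + M₀) / η ^ 2) := ⟨_, rfl⟩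
  refine ⟨max (max X' r₁) R, hX'0.le.trans ((le_max_left _ _).trans (le_max_left _ _)),
    fun r hr => ?_⟩
  have hrX' : X' ≤ r := (le_max_left _ _).trans ((le_max_left _ _).trans hr)
  have hrr₁ : r₁ ≤ r := (le_max_right _ _).trans ((le_max_left _ _).trans hr)
  have hrR : R ≤ r := (le_max_right _ _).trans hr
  have hr1 : 1 ≤ r := hX'1.trans hrX'
  have hr0 : 0 < r := by linarith
  obtain ⟨L, hL⟩ : ∃ L : ℝ, L = Real.log r := ⟨_, rfl⟩
  have hL1 : 1 ≤ L := by
    rw [hL, ← Real.log_exp 1]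
    exact Real.log_le_log (Real.exp_pos 1) (hX'e.trans hrX')
  have hLK : 2 * (|K| + M₀) / η ^ 2 ≤ L := by
    rw [hL, ← Real.log_exp (2 * (|K| + M₀) / η ^ 2)]
    exact Real.log_le_log (Real.exp_pos _) (by rw [← hR]; exact hrR)
  have hKM : 2 * (K + (M₀ : ℝ)) ≤ L * η ^ 2 := by
    have h1 := (div_le_iff₀ (by positivity : (0 : ℝ) < η ^ 2)).1 hLK
    linarith [le_abs_self K]
  -- (1) at `T = r`
  have hN1 := hlow r hr1
  rw [← hL, Set.ncard_eq_toFinset_card _ (hSfin r)] at hN1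
  set s : Finset ι := (hSfin r).toFinset with hs
  have hs_mem : ∀ i : ι, i ∈ s → |γ i| ≤ r := fun i hi => (hSfin r).mem_toFinset.1 hi
  -- the multiplicity function and the saturation predicate
  set m : ℝ → ℝ := fun x => ({i : ι | γ i = x}.ncard : ℝ) with hm
  set sat : ℝ → Prop := fun x => (c - η) * Real.log |x| ≤ m x with hsat
  -- the far indices `s₁`, their values `P`, the saturated values `Z`
  set s₁ : Finset ι := s.filter (fun i => X' ≤ |γ i|) with hs₁
  have hPmem : ∀ x ∈ s₁.image γ,
      X' ≤ |x| ∧ |x| ≤ r ∧ weilMellin u (1 / 2 + (x : ℂ) * I) = 0 := by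
    intro x hx
    obtain ⟨i, hi, rfl⟩ := Finset.mem_image.1 hx
    obtain ⟨hi1, hi2⟩ := Finset.mem_filter.1 hi
    exact ⟨hi2, hs_mem i hi1, hvan i⟩
  have hlogx : ∀ x ∈ s₁.image γ, 0 ≤ Real.log |x| ∧ Real.log |x| ≤ L := fun x hx => by
    obtain ⟨h1, h2, -⟩ := hPmem x hx
    rw [hL]
    exact ⟨Real.log_nonneg (hX'1.trans h1), Real.log_le_log (by linarith) h2⟩
  refine ⟨(s₁.image γ).filter sat, fun x hx => ?_, ?_⟩
  · obtain ⟨hxP, hxsat⟩ := Finset.mem_filter.1 hx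
    obtain ⟨h1, h2, h3⟩ := hPmem x hxP
    exact ⟨hX'1.trans h1, h2, h3, hxsat⟩
  · -- (2) the upper bound by fibres
    have hsplit : s₁.card + (s.filter (fun i => ¬ (X' ≤ |γ i|))).card = s.card :=
      Finset.card_filter_add_card_filter_not _
    have hs₀M : (s.filter (fun i => ¬ (X' ≤ |γ i|))).card ≤ M₀ := by
      have hsub : (↑(s.filter (fun i => ¬ (X' ≤ |γ i|))) : Set ι) ⊆ {i : ι | |γ i| ≤ X'} := by
        intro i hi
        have h := (Finset.mem_filter.1 (Finset.mem_coe.1 hi)).2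
        show |γ i| ≤ X'
        linarith [not_le.1 h]
      have h := Set.ncard_le_ncard hsub (hSfin X')
      rw [Set.ncard_coe_finset] at h
      rwa [hM₀]
    have hs₁sum : (s₁.card : ℝ) ≤ ∑ x ∈ s₁.image γ, m x := by
      have e : (s₁.card : ℝ) =
          ∑ x ∈ s₁.image γ, ((s₁.filter (fun i => γ i = x)).card : ℝ) := by
        rw [Finset.card_eq_sum_card_image γ s₁]
        push_cast
        rfl
      rw [e]
      refine Finset.sum_le_sum fun x _ => ?_
      have hsub' : (↑(s₁.filter (fun j => γ j = x)) : Set ι) ⊆ {j : ι | γ j = x} :=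
        fun j hj => (Finset.mem_filter.1 (Finset.mem_coe.1 hj)).2
      have h := Set.ncard_le_ncard hsub' (hFfin x)
      rw [Set.ncard_coe_finset] at h
      simp only [hm]
      exact_mod_cast h
    have hPsplit : ∑ x ∈ s₁.image γ, m x =
        ∑ x ∈ (s₁.image γ).filter sat, m x +
          ∑ x ∈ (s₁.image γ).filter (fun x => ¬ sat x), m x :=
      (Finset.sum_filter_add_sum_filter_not _ sat m).symm
    have hZsum : ∑ x ∈ (s₁.image γ).filter sat, m x ≤
        (((s₁.image γ).filter sat).card : ℝ) * ((c + δ) * L) := by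
      have h : ∑ x ∈ (s₁.image γ).filter sat, m x ≤
          ∑ _x ∈ (s₁.image γ).filter sat, (c + δ) * L := by
        refine Finset.sum_le_sum fun x hx => ?_
        obtain ⟨hxP, -⟩ := Finset.mem_filter.1 hx
        obtain ⟨h1, -, -⟩ := hPmem x hxP
        obtain ⟨-, hlL⟩ := hlogx x hxP
        have hcap := hX ι γ hγ x (hXX'.trans h1)
        rw [← hc] at hcap
        calc m x ≤ (c + δ) * Real.log |x| := hcap
          _ ≤ (c + δ) * L := mul_le_mul_of_nonneg_left hlL (by positivity)
      rwa [Finset.sum_const, nsmul_eq_mul] at h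
    have hUsum : ∑ x ∈ (s₁.image γ).filter (fun x => ¬ sat x), m x ≤
        (((s₁.image γ).filter (fun x => ¬ sat x)).card : ℝ) * ((c - η) * L) := by
      have h : ∑ x ∈ (s₁.image γ).filter (fun x => ¬ sat x), m x ≤
          ∑ _x ∈ (s₁.image γ).filter (fun x => ¬ sat x), (c - η) * L := by
        refine Finset.sum_le_sum fun x hx => ?_
        obtain ⟨hxP, hns⟩ := Finset.mem_filter.1 hx
        obtain ⟨-, hlL⟩ := hlogx x hxP
        have hlt : m x < (c - η) * Real.log |x| := lt_of_not_ge hns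
        have h' : (c - η) * Real.log |x| ≤ (c - η) * L :=
          mul_le_mul_of_nonneg_left hlL (sub_nonneg.2 hηc)
        linarith
      rwa [Finset.sum_const, nsmul_eq_mul] at h
    have hZU : ((s₁.image γ).filter sat).card +
        ((s₁.image γ).filter (fun x => ¬ sat x)).card = (s₁.image γ).card :=
      Finset.card_filter_add_card_filter_not _
    have hPcard : ((s₁.image γ).card : ℝ) ≤ (b + δ) * r :=
      hr₁ r hrr₁ (s₁.image γ) fun x hx => ⟨(hPmem x hx).2.1, (hPmem x hx).2.2⟩
    -- (3) assemble
    have hN2 : (s.card : ℝ) ≤ M₀ + (((s₁.image γ).filter sat).card : ℝ) * ((c + δ) * L) +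
        (((s₁.image γ).filter (fun x => ¬ sat x)).card : ℝ) * ((c - η) * L) := by
      have h1 : (s.card : ℝ) = s₁.card + (s.filter (fun i => ¬ (X' ≤ |γ i|))).card := by
        exact_mod_cast hsplit.symm
      have h2 : ((s.filter (fun i => ¬ (X' ≤ |γ i|))).card : ℝ) ≤ M₀ := by exact_mod_cast hs₀M
      linarith [hs₁sum, hPsplit, hZsum, hUsum]
    have hP' : (((s₁.image γ).filter sat).card : ℝ) +
        (((s₁.image γ).filter (fun x => ¬ sat x)).card : ℝ) ≤ (b + δ) * r := by
      have h : (((((s₁.image γ).filter sat).card +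
          ((s₁.image γ).filter (fun x => ¬ sat x)).card : ℕ)) : ℝ) = (s₁.image γ).card := by
        exact_mod_cast hZU
      push_cast at h
      linarith
    exact saturationProfile_budget hη hδ0 hηc hbc hδs hL1 hr1 (Nat.cast_nonneg _)
      (Nat.cast_nonneg _) hKM hN1 hN2 hP'

/-! ## §3 The registered stub -/

/-- **stub_saturationProfile (RH-FREE; the counting budget closes).** Let `a ≥ (log 3)/2`, `u` a
ground state of `[-a, a]` whose transform obeys the Levinson–Cartwright upper density bound on its
real zeros (hypothesis), and `γ` a level-`2a` family lying INSIDE the real zero set of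
`û(1/2 + i·)`. Then for every `η > 0` and all large `r` at least `(2a/π − η) r` real zeros `x`
with `|x| ≤ r` are saturated: `(1/(2a) − η) log|x| ≤ #{i | γ i = x}`. Proof: WLOG
`η ≤ 1/(2a)` (`saturationProfile_core` at `min η (1/(2a))`, all selected points having
`|x| ≥ 1`); the core is the two-sided counting law `N_γ(r) ≥ (r/π) log r − O(r)`
(`stub_countingLaw` for `γ` and `−γ`, `2a ≥ log 3 > log 2`) against the fibre decomposition
`N_γ(r) ≤ O(1) + #Z (1/(2a) + δ) log r + #U (1/(2a) − η) log r`, `#Z + #U ≤ (2a/π + δ) r`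
(sharp cap `ncard_fibre_le_sharp`, density hypothesis). [folklore] -/
theorem stub_saturationProfile :
    ∀ a : ℝ, Real.log 3 / 2 ≤ a → ∀ u : ℝ → ℂ, Literature.NumberTheory.LFunctions.IsWeilGroundState a u →
      (∀ η : ℝ, 0 < η → ∃ r₀ : ℝ, ∀ r : ℝ, r₀ ≤ r → ∀ Z : Finset ℝ,
        (∀ x ∈ Z, |x| ≤ r ∧
          Literature.NumberTheory.LFunctions.weilMellin u (1 / 2 + (x : ℂ) * Complex.I) = 0) →
          (Z.card : ℝ) ≤ (2 * a / Real.pi + η) * r) →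
      ∀ (ι : Type) (γ : ι → ℝ),
        (∀ g : ℝ → ℂ, Literature.NumberTheory.LFunctions.IsWeilTest g →
          tsupport g ⊆ Set.Icc (-(2 * a)) (2 * a) →
            HasSum (fun i => Literature.NumberTheory.LFunctions.weilMellin g (1 / 2 + (γ i : ℂ) * Complex.I))
              (Literature.NumberTheory.LFunctions.weilFunctional g)) →
        (∀ i : ι, Literature.NumberTheory.LFunctions.weilMellin u (1 / 2 + (γ i : ℂ) * Complex.I) = 0) →
        ∀ η : ℝ, 0 < η → ∃ r₀ : ℝ, ∀ r : ℝ, r₀ ≤ r → ∃ Z : Finset ℝ,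
          (∀ x ∈ Z, |x| ≤ r ∧
            Literature.NumberTheory.LFunctions.weilMellin u (1 / 2 + (x : ℂ) * Complex.I) = 0 ∧
            (1 / (2 * a) - η) * Real.log |x| ≤ ({i : ι | γ i = x}.ncard : ℝ)) ∧
          (2 * a / Real.pi - η) * r ≤ (Z.card : ℝ) := by
  intro a ha u _ H1 ι γ hγ hvan η hη
  have hlog3 : 0 < Real.log 3 := Real.log_pos (by norm_num)
  have ha0 : 0 < a := by linarith
  have ha2 : Real.log 2 ≤ 2 * a := by
    have h := Real.log_lt_log (by norm_num : (0 : ℝ) < 2) (by norm_num : (2 : ℝ) < 3)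
    linarith
  have hη'0 : 0 < min η (1 / (2 * a)) := lt_min hη (by positivity)
  have hη'η : min η (1 / (2 * a)) ≤ η := min_le_left _ _
  have hη'a : min η (1 / (2 * a)) ≤ 1 / (2 * a) := min_le_right _ _
  obtain ⟨r₀, hr₀, H⟩ := saturationProfile_core ha0 ha2 rfl rfl hη'0 hη'a u H1 hγ hvan
  refine ⟨r₀, fun r hr => ?_⟩
  obtain ⟨Z, hZ, hcount⟩ := H r hr
  refine ⟨Z, fun x hx => ?_, le_trans ?_ hcount⟩
  · obtain ⟨h1, h2, h3, h4⟩ := hZ x hx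
    exact ⟨h2, h3, le_trans (mul_le_mul_of_nonneg_right (by linarith) (Real.log_nonneg h1)) h4⟩
  · exact mul_le_mul_of_nonneg_right (by linarith) (by linarith)

end Summit.RiemannHypothesis.RiemannHypothesis.Theorems.SpectralTraceWindowStep

end
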